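import Summits.BirchSwinnertonDyer.Rank1Residual.F1Sign2.ThetaUnitTransportAtTwo
import HarnessLib

/-!
# AN-40 kernel — -an g23's two glue lemmas (re-threaded through REF1 §202's mandatory binders) and REF1 §202's kernel certificates K202.1–5
# for `ThetaUnitTransportAtTwo.lean` (typer -ty g18; proofs only, no new `def`)

Sources: `HOME/MEMO-an-data/g23/lean/Sketch_g23.lean` **6c9d350391305f0b** (lemmas `nonTorsion_of_convolutionLaw` l.117–131, `evenOnIdentityComponent_of_lawAllFundamental`
l.282–289) and `HOME/REF1-data/b202/Probe202.lean` **6b0de3571c442ec6** (K202.1 `kummerConvolutionFinite_one`, K202.2 `heegnerParityRHS_neg_eight_of_not_pos`, K202.3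
`heegnerParityRHS_neg_four_of_not_pos`, K202.4 `not_heegnerParityRHS_neg_eight_of_pos`, K202.5 `heegnerParityRHS_neg_four_iff_of_pos`; std axioms).
DELTAS (all forced by the statement file's REF1-mandated repairs, REF1 §202 R202a): (1) `nonTorsion_of_convolutionLaw` gains the hypothesis `(hsha : ShaTwoTrivial W)`
fed to AN-40b′s C′ form — otherwise VERBATIM; (2) `evenOnIdentityComponent_of_lawAllFundamental` is stated POINTWISE under `ShaTwoTrivial W` and `4 < |d_K|` (AN-40e's
C′₁ / R202c binders; AN-40z itself is filed verbatim without them, so the sketched implication AN-40e ⇒ AN-40z no longer type-checks as a whole); (3) K202.2 becomes the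
`iff` with `τ₂ ∨ β` that the repaired `8 ∣ D` branch reads (R202a(ii)) — REF1's original K202.2 certified the SKETCHED branch `Odd a₁ = True`, which is exactly the (‡)
kill; K202.1, K202.3, K202.4, K202.5 VERBATIM (their branches are untouched by the repair).  Nothing here bears on BSD; 23715 not closed.
-/

namespace Summit.BirchSwinnertonDyer.Rank1Residual.F1Sign2.ANg23

open Literature.NumberTheory.EllipticCurves Literature.NumberTheory.EllipticCurves.ModularForms UpperHalfPlane
open Summit.BirchSwinnertonDyer.Rank1Residual.F1Sign2
open Summit.BirchSwinnertonDyer.Rank1Residual.F1Sign2.TranspositionDoor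
open scoped ModularForm
open CongruenceSubgroup
open scoped Classical
open Summit.BirchSwinnertonDyer.Rank1Residual.F1Sign2.WildPacket (LocallyPrimitiveAtTwo)

/-! ## -an g23's glue lemmas (Sketch_g23 l.117–131, l.282–289), re-threaded through REF1 §202's mandatory binders -/

/-- Bookkeeping (proved; -an g23 Sketch_g23 l.117–131 VERBATIM but for the hypothesis `hsha : ShaTwoTrivial W`, added by the typer to feed AN-40b's
REF1-mandated C′ form, R202a(i)): AN-40b implies AN-40n pointwise, because an odd index is a non-zero index and a torsion `P` has index `0`
(`ℤP + tors = tors` has infinite index in the infinite group `E(K)`; that last step is kept as the explicit hypothesis `h0` — prover-sized, REF1 §202). -/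
theorem nonTorsion_of_convolutionLaw (hL : HeegnerIndexKummerConvolutionLawAtTwo)
    (W : WeierstrassCurve ℚ) [W.IsElliptic] [W.IsGloballyMinimal] [W.IsIntegral ℤ] [NeZero (W.conductorNorm ℤ)]
    (hN : (W.conductorNorm ℤ).Prime) (hr : W.analyticRank = 1) (hρ : W.HasSurjectiveModNGaloisRep 2) (ht : Odd W.torsionOrder)
    (hsha : ShaTwoTrivial W)
    (K : Type) [Field K] [NumberField K] (hK : IsImaginaryQuadratic K) (hodd : Odd (NumberField.discr K))
    (hcop : IsCoprime (NumberField.discr K) (W.conductorNorm ℤ : ℤ))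
    (Dt : ModularParametrizationData W (W.conductorNorm ℤ)) (H : HeegnerDatum (W.conductorNorm ℤ) (NumberField.discr K))
    (ι : K →+* ℂ) (P : (W.baseChange K).toAffine.Point) (hc : Odd Dt.c)
    (hP : WeierstrassCurve.Affine.Point.map ι.toRatAlgHom P = heegnerPointComplex Dt H)
    (h0 : IsOfFinAddOrder P → heegnerIndexOf W P = 0)
    (hcount : Odd (kummerConvolutionCount W (NumberField.discr K).natAbs)) : ¬ IsOfFinAddOrder P := by
  intro hfin
  have hidx := (hL W hN hr hρ ht hsha K hK hodd hcop Dt H ι P hc hP).mpr hcount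
  rw [h0 hfin] at hidx
  exact (Nat.not_odd_iff_even.mpr (by decide : Even 0)) hidx

/-- -an g23's `evenOnIdentityComponent_of_lawAllFundamental` (Sketch_g23 l.282–289: «AN-40z is the `Δ > 0`, `¬MeetsEgg` case of AN-40e — the right-hand side
is `False` there»), re-stated POINTWISE by the typer: AN-40e is filed only in REF1's C′ form (binders `ShaTwoTrivial W`, `4 < |d_K|`; R202a(i)/R202c) while
AN-40z is filed verbatim without them, so the implication now delivers AN-40z's conclusion on the `ShaTwoTrivial`, `4 < |d_K|` part; proof VERBATIM. -/
theorem evenOnIdentityComponent_of_lawAllFundamental (hL : HeegnerIndexParityLawAllFundamentalAtTwo)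
    (W : WeierstrassCurve ℚ) [W.IsElliptic] [W.IsGloballyMinimal] [W.IsIntegral ℤ] [NeZero (W.conductorNorm ℤ)]
    (hN : (W.conductorNorm ℤ).Prime) (hN2 : W.conductorNorm ℤ ≠ 2) (hr : W.analyticRank = 1) (hρ : W.HasSurjectiveModNGaloisRep 2)
    (ht : Odd W.torsionOrder) (hsha : ShaTwoTrivial W) (hΔ : 0 < W.Δ) (hegg : ¬ MeetsEgg W)
    (K : Type) [Field K] [NumberField K] (hK : IsImaginaryQuadratic K) (hD : 4 < (NumberField.discr K).natAbs)
    (hcop : IsCoprime (NumberField.discr K) (W.conductorNorm ℤ : ℤ))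
    (Dt : ModularParametrizationData W (W.conductorNorm ℤ)) (H : HeegnerDatum (W.conductorNorm ℤ) (NumberField.discr K))
    (ι : K →+* ℂ) (P : (W.baseChange K).toAffine.Point) (hc : Odd Dt.c)
    (hP : WeierstrassCurve.Affine.Point.map ι.toRatAlgHom P = heegnerPointComplex Dt H) :
    Even (heegnerIndexOf W P) := by
  have h := hL W hN hN2 hr hρ ht hsha K hK hD hcop Dt H ι P hc hP
  rw [← Nat.not_odd_iff_even, h]
  simp only [heegnerParityRHS, hΔ, if_true]
  exact fun hh => hegg hh.1

/-! ## REF1 §202 kernel certificates (Probe202.lean; sorry-free; std axioms) — the right-hand side of AN-40e at the degenerate / (‡) discriminants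
`D = -8`, `D = -4`, evaluated by the kernel (K202.1, K202.3, K202.4, K202.5 VERBATIM; K202.2 adapted to the repaired `8 ∣ D` branch). -/

/-- K202.1: the finite Kummer convolution at `u = 1` is empty: `s_E(1) = 0`. -/
theorem kummerConvolutionFinite_one (W : WeierstrassCurve ℚ) [W.IsIntegral ℤ] :
    kummerConvolutionFinite W 1 = 0 := by
  simp [kummerConvolutionFinite, Nat.primeFactors_one]

/-- K202.2′ ((‡), `D = -8`, i.e. `K = ℚ(√-2)`, `u = 1`; REF1's K202.2 ADAPTED by the typer to the repaired branch, R202a(ii)): at `Δ_W ≤ 0` the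
right-hand side of AN-40e at `D = -8` (`8 % 8 = 0`-branch: `Odd (a_1) ∧ (τ₂ ∨ β)`, `a_1 = 1` by `WeierstrassCurve.LFunction_apply_one`) READS EXACTLY the
2-adic bit `τ₂(W) ∨ β(W)`.  REF1's original K202.2 certified that the SKETCHED branch was `True` here — i.e. that -an's AN-40e asserted `I(y_{ℚ(√-2)})` ODD on
every `Δ < 0`, `N ≡ 1, 3 (mod 8)` curve with no dependence on `[g ∉ 2E(ℚ₂)]`; REF2 v54 §7.3 (‡) / PREDICTION #9 + REF1 §202: at `1051a1`, `1259a1`, `1987a1`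
(`Δ < 0`, `a₂ = 0`, `g ∈ 2E(ℚ₂)`) Kramer 1981 Prop. 4 + `res_K` give `Ш(E/K)[2] ≠ 0`, so GZ–BSD₂ gives EVEN — the repaired branch says EVEN there too. -/
theorem heegnerParityRHS_neg_eight_iff_of_not_pos (W : WeierstrassCurve ℚ) [W.IsElliptic] [W.IsIntegral ℤ]
    (hΔ : ¬ 0 < W.Δ) : heegnerParityRHS W (-8) ↔ (HasTwoAdicTwoTorsion W ∨ LocallyPrimitiveAtTwo W) := by
  simp [heegnerParityRHS, hΔ, WeierstrassCurve.LFunction_apply_one]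

/-- K202.3 (`D = -4`, i.e. `K = ℚ(i)`, `u_K = 2`): at `Δ_W ≤ 0` the typed RHS of AN-40e HOLDS at `D = -4` for BOTH values
of `τ₂` (`4 % 8 = 4`-branch: `Odd (a_1 + [¬τ₂]·s_E(1)) = Odd (1 + 0)`).  Hence AN-40e asserts `I(y_{ℚ(i)})` ODD on every
curve of its class with `Δ < 0` and `N ≡ 1 (mod 4)` — the `u_K = #𝓞_K^× / 2 = 2` case that Gross 1991 §1 (p. 235,
"we assume D ≠ 3, 4") and Gross–Zagier V.(2.2) treat separately (R202c). -/
theorem heegnerParityRHS_neg_four_of_not_pos (W : WeierstrassCurve ℚ) [W.IsElliptic] [W.IsIntegral ℤ]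
    (hΔ : ¬ 0 < W.Δ) : heegnerParityRHS W (-4) := by
  by_cases hτ : HasTwoAdicTwoTorsion W <;>
    simp [heegnerParityRHS, hΔ, hτ, WeierstrassCurve.LFunction_apply_one, kummerConvolutionFinite_one]

/-- K202.4 (`Δ > 0`, `8 ∣ D`): the typed RHS is `False`, i.e. AN-40e asserts `I(y_{-8u})` EVEN on every `Δ > 0` curve —
consistent with the bookkeeping (at `Δ > 0` the place `2` is never the unique marked place). -/
theorem not_heegnerParityRHS_neg_eight_of_pos (W : WeierstrassCurve ℚ) [W.IsIntegral ℤ] (hΔ : 0 < W.Δ) :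
    ¬ heegnerParityRHS W (-8) := by
  simp [heegnerParityRHS, hΔ]

/-- K202.5 (`Δ > 0`, `D = -4`): the typed RHS reads `MeetsEgg W ∧ ¬τ₂(W)` (`a_1 = 1`), i.e. AN-40e asserts `I(y_{ℚ(i)})` ODD
exactly on the egg-meeting curves without `2`-adic `2`-torsion (e.g. `37a1`), again a `u_K = 2` instance (R202c). -/
theorem heegnerParityRHS_neg_four_iff_of_pos (W : WeierstrassCurve ℚ) [W.IsElliptic] [W.IsIntegral ℤ] (hΔ : 0 < W.Δ) :
    heegnerParityRHS W (-4) ↔ (MeetsEgg W ∧ ¬ HasTwoAdicTwoTorsion W) := by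
  simp [heegnerParityRHS, hΔ, WeierstrassCurve.LFunction_apply_one]


/-! ## A40-T2 (-an g23's ask to -ty and -es, MEMO-an v1.64 §26.3 / §26.9): the `S₄` TRACE LEMMA by brute force on `M₂(𝔽₂)` (typer -ty g18; `decide`) -/

/-- The `GL₂(𝔽₂) = S₃`-stable copy `V = {0, E+F, I+E, I+F}` of `E[2]` inside `sl₂(𝔽₂) ⊂ M₂(𝔽₂)` (`E = !![0,1;0,0]`, `F = !![0,0;1,0]`): `V` is closed under
conjugation by every `σ ∈ SL₂(𝔽₂) = GL₂(𝔽₂)` (`σ⁻¹ = σ⁵` since `#GL₂(𝔽₂) = 6`), so `V ⋊ GL₂(𝔽₂)` (conjugation action) is defined — it is `AGL₂(𝔽₂) ≅ S₄`, the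
shape of `Gal(ℚ(E[2], ½g)/ℚ)` for a big-image curve with generator `g` (MEMO-an §26.3).  Brute force over the `16 × 16` matrix pairs. -/
theorem kummerCopy_conj_stable : ∀ σ v : Matrix (Fin 2) (Fin 2) (ZMod 2), σ.det = 1 →
    (v = 0 ∨ v = !![0, 1; 1, 0] ∨ v = !![1, 1; 0, 1] ∨ v = !![1, 0; 1, 1]) →
    (σ * v * (σ * σ * σ * σ * σ) = 0 ∨ σ * v * (σ * σ * σ * σ * σ) = !![0, 1; 1, 0] ∨
      σ * v * (σ * σ * σ * σ * σ) = !![1, 1; 0, 1] ∨ σ * v * (σ * σ * σ * σ * σ) = !![1, 0; 1, 1]) := by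
  decide

/-- **The `S₄` trace lemma** (-an's A40-T2, certified): for `σ ∈ GL₂(𝔽₂)` and `v ∈ V`, the element `(v, σ)` of `V ⋊ GL₂(𝔽₂) ≅ S₄` is a `4`-CYCLE — i.e. has
order `4`: `σ` is an involution and `(v,σ)² = (v + σvσ⁻¹, 1) ≠ 1`, i.e. `σvσ ≠ v` (elements over a 3-cycle `σ` have order `3`, over `σ = 1` order `≤ 2`) —
**iff `tr(v·σ) = 1`**.  Hence -an's Kummer line bit `t(ℓ) = [Frob_ℓ is a 4-cycle in Gal(ℚ(E[2], ½g)/ℚ)]` (`KummerBitAt`) is the first-order TRACE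
`tr((1 + νX_κ)ρ̄(Frob_ℓ))`'s `ν`-coefficient, the reading behind AN-40s `HeegnerParityHeckeModuleLawAtTwo`'s `T_ℓ ↦ (1 + h(ℓ)ν₁)(a_ℓ + t(ℓ)ν₂)`. -/
theorem fourCycle_iff_trace_one : ∀ σ v : Matrix (Fin 2) (Fin 2) (ZMod 2), σ.det = 1 →
    (v = 0 ∨ v = !![0, 1; 1, 0] ∨ v = !![1, 1; 0, 1] ∨ v = !![1, 0; 1, 1]) →
    ((σ * σ = 1 ∧ σ ≠ 1 ∧ σ * v * σ ≠ v) ↔ Matrix.trace (v * σ) = 1) := by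
  decide

end Summit.BirchSwinnertonDyer.Rank1Residual.F1Sign2.ANg23
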